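import Summits.AtomisticToContinuum.BoseEinsteinCondensation.Theorems.BECRichardsonGaudinRichardsonAnchorBECBornDefs
import HarnessLib

/-!
# Elementary-symmetric-sum ratio bounds (crux `RichardsonAnchorBEC`, stub `stub_esymmRatioBounds`)

Pure combinatorial / real inequalities feeding the estimates of the Born trial state of the route
`BECRichardsonGaudin` (stmt-AtomisticToContinuum-14805, line `registered`).

For a finset `s`, non-negative weights `x` and `e_j = ∑_{t ⊆ s, |t| = j} ∏_{a ∈ t} x_a` (sums over
`Finset.powersetCard`), `p = ∑_{a ∈ s} x_a`, we prove the double-counting identity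
`p · e_j = (j+1) · e_{j+1} + ∑_{|t| = j} x^t · ∑_{a ∈ t} x_a`
(pairs `(t, a)` with `a ∉ t` are in bijection with pairs `(t', a)`, `t' = insert a t`, `a ∈ t'`,
via `Finset.sum_sigma'` and `Finset.sum_nbij'`), and deduce
* `(j+1) e_{j+1} ≤ p e_j`;
* `p e_j ≤ (j+1) e_{j+1} + j X e_j` if `x ≤ X` on `s`;
* the size-biased bounds `∑_t x^t (∑_{a∈t} w_a) ≤ j Wm e_j`, `∑_t x^t (∑_{a∈t} w_a)² ≤ (j Wm)² e_j`
  for `0 ≤ w ≤ Wm` on `s`;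
* monotonicity `e_j(s.erase a) ≤ e_j(s)`.
A second, independent block: for a non-negative real sequence `W` with
`(j+1) W_{j+1} ≤ m W_j` (`j < J`), the first moment bound `∑_{j ≤ J} j W_j ≤ m ∑_{j ≤ J} W_j` and the
geometric tail bound `W_J ≤ (1/2)^{J-j₀} ∑_{j ≤ J} W_j` for `2m ≤ j₀ ≤ J`.

Only Mathlib finset algebra is used (`Finset.sum_sdiff`, `Finset.prod_insert`,
`Finset.sum_le_sum_of_subset_of_nonneg`, `Finset.sum_range_succ'`, `Finset.single_le_sum`).
-/

noncomputable section

open MeasureTheory Filter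
open scoped ENNReal NNReal ComplexConjugate BigOperators

namespace Summit.AtomisticToContinuum.BoseEinsteinCondensation.Cruxes.RichardsonAnchorBEC.Birth

open Literature.MathematicalPhysics.QuantumManyBody.BoseGas

/-- Double counting: summing `x^(insert a t)` over `|t| = j`, `t ⊆ s`, `a ∈ s \ t` gives
`(j+1) · e_{j+1}`, since every `t'` with `|t'| = j + 1` arises from exactly `j + 1` pairs. [folklore] -/
theorem esymm_double_count {α : Type*} [DecidableEq α] (s : Finset α) (x : α → ℝ) (j : ℕ) :
    (∑ t ∈ s.powersetCard j, ∑ a ∈ s \ t, ∏ b ∈ insert a t, x b) =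
      ((j : ℝ) + 1) * ∑ t ∈ s.powersetCard (j + 1), ∏ b ∈ t, x b := by
  have hconst : ∀ t ∈ s.powersetCard (j + 1),
      ((j : ℝ) + 1) * ∏ b ∈ t, x b = ∑ _a ∈ t, ∏ b ∈ t, x b := by
    intro t ht
    rw [Finset.sum_const, nsmul_eq_mul, (Finset.mem_powersetCard.1 ht).2]
    push_cast
    ring
  rw [Finset.mul_sum, Finset.sum_congr rfl hconst, Finset.sum_sigma', Finset.sum_sigma']
  refine Finset.sum_nbij' (fun p => ⟨insert p.2 p.1, p.2⟩) (fun p => ⟨p.1.erase p.2, p.2⟩)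
    ?_ ?_ ?_ ?_ ?_
  · rintro ⟨t, a⟩ hp
    simp only [Finset.mem_sigma, Finset.mem_powersetCard, Finset.mem_sdiff] at hp ⊢
    obtain ⟨⟨hts, hcard⟩, has, hat⟩ := hp
    exact ⟨⟨Finset.insert_subset has hts, by rw [Finset.card_insert_of_notMem hat, hcard]⟩,
      Finset.mem_insert_self a t⟩
  · rintro ⟨t, a⟩ hp
    simp only [Finset.mem_sigma, Finset.mem_powersetCard, Finset.mem_sdiff] at hp ⊢
    obtain ⟨⟨hts, hcard⟩, hat⟩ := hp
    exact ⟨⟨(Finset.erase_subset a t).trans hts,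
      by rw [Finset.card_erase_of_mem hat, hcard, Nat.add_sub_cancel]⟩, hts hat,
      Finset.notMem_erase a t⟩
  · rintro ⟨t, a⟩ hp
    simp only [Finset.mem_sigma, Finset.mem_powersetCard, Finset.mem_sdiff] at hp
    rw [Finset.erase_insert hp.2.2]
  · rintro ⟨t, a⟩ hp
    simp only [Finset.mem_sigma] at hp
    rw [Finset.insert_erase hp.2]
  · rintro ⟨t, a⟩ _
    rfl

/-- The double-counting identity `p · e_j = (j+1) · e_{j+1} + ∑_{|t| = j} x^t · ∑_{a ∈ t} x_a` for the
elementary symmetric sums `e_j = ∑_{t ⊆ s, |t| = j} ∏_{a∈t} x_a` and `p = ∑_{a∈s} x_a`. [folklore] -/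
theorem esymm_mul_sum_identity {α : Type*} [DecidableEq α] (s : Finset α) (x : α → ℝ) (j : ℕ) :
    (∑ a ∈ s, x a) * ∑ t ∈ s.powersetCard j, ∏ a ∈ t, x a =
      ((j : ℝ) + 1) * (∑ t ∈ s.powersetCard (j + 1), ∏ a ∈ t, x a) +
        ∑ t ∈ s.powersetCard j, (∏ a ∈ t, x a) * ∑ a ∈ t, x a := by
  rw [← esymm_double_count, ← Finset.sum_add_distrib, Finset.mul_sum]
  refine Finset.sum_congr rfl fun t ht => ?_
  have hts : t ⊆ s := (Finset.mem_powersetCard.1 ht).1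
  rw [← Finset.sum_sdiff hts, add_mul, Finset.sum_mul, Finset.sum_mul, Finset.mul_sum]
  congr 1
  · refine Finset.sum_congr rfl fun a ha => ?_
    rw [Finset.prod_insert (Finset.mem_sdiff.1 ha).2]
  · exact Finset.sum_congr rfl fun a _ => mul_comm _ _

/-- **Stub `stub_esymmRatioBounds` (U3).** Block 1: for non-negative weights `x` on a finset `s` and the
elementary symmetric sums `e_j = ∑_{t ⊆ s, |t| = j} ∏_{a∈t} x_a`, `p = ∑_s x`:
(a) `(j+1) e_{j+1} ≤ p e_j`; (b) `p e_j ≤ (j+1) e_{j+1} + j X e_j` if `x ≤ X` on `s`;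
(c) `∑_t x^t (∑_{a∈t} w_a) ≤ j Wm e_j` and `∑_t x^t (∑_{a∈t} w_a)² ≤ (j Wm)² e_j` for `0 ≤ w ≤ Wm`;
(d) `e_j(s.erase a) ≤ e_j(s)`.
Block 2: for `W ≥ 0`, `m ≥ 0` with `(j+1) W_{j+1} ≤ m W_j` (`j < J`):
`∑_{j≤J} j W_j ≤ m ∑_{j≤J} W_j` and `W_J ≤ (1/2)^{J-j₀} ∑_{j≤J} W_j` whenever `2m ≤ j₀ ≤ J`. [folklore] -/
theorem stub_esymmRatioBounds :
    (∀ {α : Type} [DecidableEq α] (s : Finset α) (x : α → ℝ), (∀ a ∈ s, 0 ≤ x a) → ∀ j : ℕ,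
      ((j : ℝ) + 1) * (∑ t ∈ s.powersetCard (j + 1), ∏ a ∈ t, x a) ≤
          (∑ a ∈ s, x a) * ∑ t ∈ s.powersetCard j, ∏ a ∈ t, x a ∧
      (∀ X : ℝ, (∀ a ∈ s, x a ≤ X) →
        (∑ a ∈ s, x a) * (∑ t ∈ s.powersetCard j, ∏ a ∈ t, x a) ≤
          ((j : ℝ) + 1) * (∑ t ∈ s.powersetCard (j + 1), ∏ a ∈ t, x a) +
            j * X * ∑ t ∈ s.powersetCard j, ∏ a ∈ t, x a) ∧
      (∀ (w : α → ℝ) (Wm : ℝ), (∀ a ∈ s, 0 ≤ w a ∧ w a ≤ Wm) →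
        (∑ t ∈ s.powersetCard j, (∏ a ∈ t, x a) * ∑ a ∈ t, w a) ≤
            j * Wm * ∑ t ∈ s.powersetCard j, ∏ a ∈ t, x a ∧
        (∑ t ∈ s.powersetCard j, (∏ a ∈ t, x a) * (∑ a ∈ t, w a) ^ 2) ≤
            (j * Wm) ^ 2 * ∑ t ∈ s.powersetCard j, ∏ a ∈ t, x a) ∧
      (∀ a ∈ s, (∑ t ∈ (s.erase a).powersetCard j, ∏ b ∈ t, x b) ≤ ∑ t ∈ s.powersetCard j, ∏ b ∈ t, x b)) ∧
    (∀ (W : ℕ → ℝ) (m : ℝ) (J : ℕ), (∀ j, 0 ≤ W j) → 0 ≤ m →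
      (∀ j, j < J → ((j : ℝ) + 1) * W (j + 1) ≤ m * W j) →
      (∑ j ∈ Finset.range (J + 1), (j : ℝ) * W j ≤ m * ∑ j ∈ Finset.range (J + 1), W j) ∧
      (∀ j₀ : ℕ, j₀ ≤ J → 2 * m ≤ (j₀ : ℝ) →
        W J ≤ (1 / 2) ^ (J - j₀) * ∑ j ∈ Finset.range (J + 1), W j)) := by
  constructor
  · intro α _ s x hx j
    have hprod_nonneg : ∀ t ∈ s.powersetCard j, 0 ≤ ∏ a ∈ t, x a := fun t ht =>
      Finset.prod_nonneg fun a ha => hx a ((Finset.mem_powersetCard.1 ht).1 ha)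
    have hid := esymm_mul_sum_identity s x j
    refine ⟨?_, ?_, ?_, ?_⟩
    · -- (a): drop the non-negative size-biased term of the identity
      rw [hid]
      have h0 : 0 ≤ ∑ t ∈ s.powersetCard j, (∏ a ∈ t, x a) * ∑ a ∈ t, x a :=
        Finset.sum_nonneg fun t ht => mul_nonneg (hprod_nonneg t ht)
          (Finset.sum_nonneg fun a ha => hx a ((Finset.mem_powersetCard.1 ht).1 ha))
      linarith
    · -- (b): bound the size-biased term by `j X e_j`
      intro X hX
      rw [hid, add_le_add_iff_left, Finset.mul_sum]
      refine Finset.sum_le_sum fun t ht => ?_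
      have hts := (Finset.mem_powersetCard.1 ht).1
      have hsum : ∑ a ∈ t, x a ≤ j * X := by
        calc ∑ a ∈ t, x a ≤ ∑ _a ∈ t, X := Finset.sum_le_sum fun a ha => hX a (hts ha)
          _ = j * X := by rw [Finset.sum_const, nsmul_eq_mul, (Finset.mem_powersetCard.1 ht).2]
      calc (∏ a ∈ t, x a) * ∑ a ∈ t, x a ≤ (∏ a ∈ t, x a) * (j * X) :=
            mul_le_mul_of_nonneg_left hsum (hprod_nonneg t ht)
        _ = j * X * ∏ a ∈ t, x a := by ring
    · -- (c): termwise `0 ≤ ∑_{a∈t} w_a ≤ j Wm`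
      intro w Wm hw
      have hwsum : ∀ t ∈ s.powersetCard j, 0 ≤ ∑ a ∈ t, w a ∧ ∑ a ∈ t, w a ≤ j * Wm := by
        intro t ht
        have hts := (Finset.mem_powersetCard.1 ht).1
        refine ⟨Finset.sum_nonneg fun a ha => (hw a (hts ha)).1, ?_⟩
        calc ∑ a ∈ t, w a ≤ ∑ _a ∈ t, Wm := Finset.sum_le_sum fun a ha => (hw a (hts ha)).2
          _ = j * Wm := by rw [Finset.sum_const, nsmul_eq_mul, (Finset.mem_powersetCard.1 ht).2]
      refine ⟨?_, ?_⟩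
      · rw [Finset.mul_sum]
        refine Finset.sum_le_sum fun t ht => ?_
        calc (∏ a ∈ t, x a) * ∑ a ∈ t, w a ≤ (∏ a ∈ t, x a) * (j * Wm) :=
              mul_le_mul_of_nonneg_left (hwsum t ht).2 (hprod_nonneg t ht)
          _ = j * Wm * ∏ a ∈ t, x a := by ring
      · rw [Finset.mul_sum]
        refine Finset.sum_le_sum fun t ht => ?_
        calc (∏ a ∈ t, x a) * (∑ a ∈ t, w a) ^ 2 ≤ (∏ a ∈ t, x a) * (j * Wm) ^ 2 :=
              mul_le_mul_of_nonneg_left (pow_le_pow_left₀ (hwsum t ht).1 (hwsum t ht).2 2)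
                (hprod_nonneg t ht)
          _ = (j * Wm) ^ 2 * ∏ a ∈ t, x a := by ring
    · -- (d): monotonicity in `s` of a sum of non-negative terms
      intro a _
      exact Finset.sum_le_sum_of_subset_of_nonneg
        (Finset.powersetCard_mono (Finset.erase_subset a s)) fun t ht _ => hprod_nonneg t ht
  · intro W m J hW hm hrec
    refine ⟨?_, fun j₀ hj₀ hmj₀ => ?_⟩
    · -- first moment: shift the index and use the ratio hypothesis termwise
      calc ∑ j ∈ Finset.range (J + 1), (j : ℝ) * W j
          = ∑ j ∈ Finset.range J, ((j : ℝ) + 1) * W (j + 1) := by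
            rw [Finset.sum_range_succ']
            simp
        _ ≤ ∑ j ∈ Finset.range J, m * W j :=
            Finset.sum_le_sum fun j hj => hrec j (Finset.mem_range.1 hj)
        _ ≤ ∑ j ∈ Finset.range (J + 1), m * W j := by
            rw [Finset.sum_range_succ]
            exact le_add_of_nonneg_right (mul_nonneg hm (hW J))
        _ = m * ∑ j ∈ Finset.range (J + 1), W j := by rw [Finset.mul_sum]
    · -- geometric tail: `W_{j+1} ≤ W_j / 2` for `j₀ ≤ j < J`
      obtain ⟨d, rfl⟩ := Nat.exists_eq_add_of_le hj₀
      have claim : ∀ k, k ≤ d → W (j₀ + k) ≤ (1 / 2) ^ k * W j₀ := by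
        intro k
        induction k with
        | zero =>
          intro _
          simp
        | succ k ih =>
          intro hk
          have h1 := hrec (j₀ + k) (by omega)
          have h2 := ih (by omega)
          have hWk := hW (j₀ + k)
          have hpos : (0 : ℝ) < ((j₀ + k : ℕ) : ℝ) + 1 := by positivity
          have hm' : m ≤ (((j₀ + k : ℕ) : ℝ) + 1) / 2 := by
            push_cast
            linarith [(k.cast_nonneg : (0 : ℝ) ≤ k)]
          have h3 : W (j₀ + k + 1) ≤ W (j₀ + k) / 2 := by
            refine le_of_mul_le_mul_left ?_ hpos
            calc (((j₀ + k : ℕ) : ℝ) + 1) * W (j₀ + k + 1) ≤ m * W (j₀ + k) := h1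
              _ ≤ (((j₀ + k : ℕ) : ℝ) + 1) / 2 * W (j₀ + k) := mul_le_mul_of_nonneg_right hm' hWk
              _ = (((j₀ + k : ℕ) : ℝ) + 1) * (W (j₀ + k) / 2) := by ring
          rw [← add_assoc, pow_succ]
          calc W (j₀ + k + 1) ≤ W (j₀ + k) / 2 := h3
            _ ≤ (1 / 2) ^ k * W j₀ / 2 := by linarith
            _ = (1 / 2) ^ k * (1 / 2) * W j₀ := by ring
      rw [Nat.add_sub_cancel_left]
      exact (claim d le_rfl).trans (mul_le_mul_of_nonneg_left
        (Finset.single_le_sum (fun j _ => hW j) (Finset.mem_range.2 (by omega))) (by positivity))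

end Summit.AtomisticToContinuum.BoseEinsteinCondensation.Cruxes.RichardsonAnchorBEC.Birth

end
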